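import Literature.Probability.LatticeModels.DiagonalTransferMatrix
import Literature.Probability.LatticeModels.TransverseIsingFermions
import Literature.Probability.LatticeModels.IsingTopVacuum
import HarnessLib

/-!
# The Perron vector of the diagonal transfer matrix is the Fock vacuum of the critical transverse-field Ising chain

Topic `Probability/LatticeModels`, namespace `Literature.Probability.LatticeModels`. Third file of
the exact computation of the critical diagonal correlations of the planar Ising model behind
`Literature.Probability.LatticeModels.wu_rhoCHI`. With `DiagonalTransferMatrix` (the two-layer
diagonal transfer matrix `T₂ = KᵀK`, entrywise positive and symmetric, commuting with the
transverse-field Ising chain `H = tfiHam N h` at `h = (sinh 2β)⁻²`, `= 1` at `β_c(2)`) and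
`TransverseIsingFermions` (the chain in Jordan–Wigner fermions: the antiperiodic bilinear `H⁺ =
tfiBil N 1 1` agrees with `H` on even vectors and with the antiferromagnetically twisted chain
`H₋ = tfiHamTw N 1 (-1)` on odd vectors; the lowering vectors `w_{q_m}` with `[H⁺, Γ(w)] = -ε Γ(w)`,
`ε = 4 sin(q_m/2) > 0`; the Fock polarization `tfiPol`), this file proves, following the argument of
T. D. Schultz, D. C. Mattis, E. H. Lieb, Rev. Mod. Phys. **36** (1964) 856, §IV for the row transfer
matrix (the tree's `IsingTopVacuum`) with the transfer matrix replaced by the commuting Hamiltonian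
(M. Suzuki, Prog. Theor. Phys. 46 (1971) 1337; the ground state of the chain: E. Lieb, T. Schultz,
D. Mattis, Ann. Phys. 16 (1961) 407, §II; P. Pfeuty, Ann. Phys. 57 (1970) 79):

* **Perron.** The positive top eigenvector `ψ` of `T₂` (Perron, `PerronSymmetric`) is flip-even
  (`diagPerron_flip_invariant`) and, by the commutation and the simplicity of the top eigenvalue,
  an eigenvector of `H`: `Hψ = μψ` (`exists_tfiHam_mulVec_diagPerron`); by positivity `μ` is the
  BOTTOM of the spectrum: `λ_max(N·1 - H) = N - μ` (`topEigenvalue_shift_tfiHam_eq`; the ground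
  state of a stoquastic matrix can be taken nonnegative and is then not orthogonal to `ψ > 0`).
* **Diamagnetic inequality.** `λ_max(N·1 - H₋) ≤ λ_max(N·1 - H)`
  (`topEigenvalue_shift_twisted_le`): frustrating one bond does not lower the ground-state energy.
  Proof: conjugate by the Hadamard rotation `U = ∏_i (σˣ_i + σᶻ_i)/√2` (`hadU`, `U σˣ U = σᶻ`,
  `U σᶻ U = σˣ`), after which the Ising bonds `σˣ_iσˣ_{i+1}` are entrywise NONNEGATIVE off-diagonal
  matrices and the twist is a sign on one of them, so `vᵀ(N - H₋)'v ≤ |v|ᵀ(N - H)'|v|` (the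
  Rayleigh quotient with absolute values, as in Perron's theorem).
* **Vacuum.** At `β = β_c(2)` (`h = 1`): for every antiperiodic momentum,
  **`Γ(w_{q_m}) ψ_ℂ = 0`** (`fieldOp_tfiLow_mulVec_diagPerron`): `φ = Γ(w)ψ_ℂ` is odd and
  `H⁺φ = (μ - ε)φ`, i.e. `(N - H₋)φ = (N - μ + ε)φ`, impossible for `φ ≠ 0` since
  `N - μ + ε > N - μ = λ_max(N - H) ≥ λ_max(N - H₋)`. Hence `ψ_ℂ` is a polarized (Fock) vacuum for
  the Ising Majorana family with the polarization `tfiPol N` (`isPolarizedVacuum_diagPerron`), and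
  Wick's theorem in determinant form (`QuasiFreeVacuum.expect_prodPairs_div`) computes `⟨ψ, · ψ⟩` —
  the diagonal cylinder state of the critical Ising model is the ground state of the critical
  transverse-field Ising chain (Suzuki 1971) and a free-fermion vacuum (Pfeuty 1970).

Everything is proved; no named fact is introduced. The determinant formula for the in-layer pair
correlation and its limit are the next files.

## References

* T. D. Schultz, D. C. Mattis, E. H. Lieb, Rev. Mod. Phys. 36 (1964) 856–871, §IV.
* E. Lieb, T. Schultz, D. Mattis, Ann. Phys. 16 (1961) 407–466, §II.
* P. Pfeuty, Ann. Phys. 57 (1970) 79–90.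
* M. Suzuki, Prog. Theor. Phys. 46 (1971) 1337–1359.
* J. Ding, A. Zhou, *Nonnegative matrices, positive operators, and applications* (2009), Thm 2.1.
-/

noncomputable section

open Matrix Complex Finset Literature.MathematicalPhysics.FreeFermions Literature.LinearAlgebra.Matrix

namespace Literature.Probability.LatticeModels

variable {N : ℕ}

/-! ### Part A. The Hadamard rotation and the diamagnetic inequality -/

section Hadamard

/-- The real diagonal spin operator `σᶻ_i = diag(r_i)` on `ℝ^{Row N}`. [cite: SchultzMattisLieb1964, §III] -/
def sigmaZR (i : Fin N) : Matrix (Row N) (Row N) ℝ := diagonal fun r => spinAt i r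

/-- `(σᶻ_i)² = 1`. [folklore] -/
theorem sigmaZR_mul_self (i : Fin N) : sigmaZR i * sigmaZR i = (1 : Matrix (Row N) (Row N) ℝ) := by
  rw [sigmaZR, diagonal_mul_diagonal, ← diagonal_one]
  congr 1
  funext r
  exact spinAt_mul_self i r

/-- Left action of `σᶻ_i`: `(σᶻ_i M)(r, r') = r_i M(r, r')`. [folklore] -/
theorem sigmaZR_mul_apply (i : Fin N) (M : Matrix (Row N) (Row N) ℝ) (r r' : Row N) :
    (sigmaZR i * M) r r' = spinAt i r * M r r' := by
  rw [sigmaZR, diagonal_mul]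

/-- Right action of `σᶻ_i`: `(M σᶻ_i)(r, r') = M(r, r') r'_i`. [folklore] -/
theorem mul_sigmaZR_apply (i : Fin N) (M : Matrix (Row N) (Row N) ℝ) (r r' : Row N) :
    (M * sigmaZR i) r r' = M r r' * spinAt i r' := by
  rw [sigmaZR, mul_diagonal]

/-- **`σˣ_i σᶻ_i = -σᶻ_i σˣ_i`** (the flip reverses the spin it reads). [folklore] -/
theorem sigmaX_mul_sigmaZR_same (i : Fin N) : sigmaX i * sigmaZR i = -(sigmaZR i * sigmaX (N := N) i) := by
  ext r r'
  rw [Matrix.neg_apply, sigmaZR_mul_apply, mul_sigmaZR_apply, sigmaX_apply]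
  split_ifs with h
  · rw [h, spinAt_flipAt_same]; ring
  · ring

/-- `σˣ_i` commutes with `σᶻ_j` for `j ≠ i`. [folklore] -/
theorem sigmaX_mul_sigmaZR_of_ne {i j : Fin N} (h : j ≠ i) : sigmaX i * sigmaZR j = sigmaZR j * sigmaX (N := N) i := by
  ext r r'
  rw [sigmaZR_mul_apply, mul_sigmaZR_apply, sigmaX_apply]
  split_ifs with h'
  · rw [h', spinAt_flipAt_ne h]; ring
  · ring

/-- Diagonal spin operators commute. [folklore] -/
theorem sigmaZR_comm (i j : Fin N) : sigmaZR i * sigmaZR j = sigmaZR j * sigmaZR (N := N) i := by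
  rw [sigmaZR, sigmaZR, diagonal_mul_diagonal, diagonal_mul_diagonal]
  congr 1; funext r; ring

/-- **The single-site Hadamard rotation** `U_i = (σˣ_i + σᶻ_i)/√2` (a real symmetric involution
exchanging `σˣ_i` and `σᶻ_i`). [folklore] -/
def hadOp (i : Fin N) : Matrix (Row N) (Row N) ℝ := (Real.sqrt 2)⁻¹ • (sigmaX i + sigmaZR i)

/-- `(1/√2)(1/√2) = 1/2`. [folklore] -/
theorem inv_sqrt_two_mul_self : (Real.sqrt 2)⁻¹ * (Real.sqrt 2)⁻¹ = (2 : ℝ)⁻¹ := by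
  rw [← mul_inv, Real.mul_self_sqrt (by norm_num : (0 : ℝ) ≤ 2)]

/-- `U_i² = 1`. [folklore] -/
theorem hadOp_mul_self (i : Fin N) : hadOp i * hadOp i = (1 : Matrix (Row N) (Row N) ℝ) := by
  have key : (sigmaX i + sigmaZR i) * (sigmaX i + sigmaZR (N := N) i) = (2 : ℝ) • (1 : Matrix (Row N) (Row N) ℝ) := by
    rw [add_mul, mul_add, mul_add, sigmaX_mul_sigmaX, sigmaZR_mul_self, sigmaX_mul_sigmaZR_same]
    module
  rw [hadOp, smul_mul_smul_comm, key, smul_smul, inv_sqrt_two_mul_self, inv_mul_cancel₀ two_ne_zero, one_smul]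

/-- `U_i σˣ_i U_i = σᶻ_i`. [folklore] -/
theorem hadOp_mul_sigmaX_mul_hadOp (i : Fin N) : hadOp i * sigmaX i * hadOp i = sigmaZR (N := N) i := by
  have key : (sigmaX i + sigmaZR i) * sigmaX i * (sigmaX i + sigmaZR (N := N) i) = (2 : ℝ) • sigmaZR i := by
    rw [add_mul, sigmaX_mul_sigmaX, add_mul, one_mul, mul_add, mul_assoc (sigmaZR i) (sigmaX i) (sigmaX i),
      sigmaX_mul_sigmaX, mul_one, mul_assoc (sigmaZR i) (sigmaX i) (sigmaZR i), sigmaX_mul_sigmaZR_same, mul_neg,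
      ← mul_assoc, sigmaZR_mul_self, one_mul]
    module
  rw [hadOp, smul_mul_assoc, mul_smul_comm, smul_mul_assoc, smul_smul, key, smul_smul, inv_sqrt_two_mul_self,
    inv_mul_cancel₀ two_ne_zero, one_smul]

/-- `U_i σᶻ_i U_i = σˣ_i`. [folklore] -/
theorem hadOp_mul_sigmaZR_mul_hadOp (i : Fin N) : hadOp i * sigmaZR i * hadOp i = sigmaX (N := N) i := by
  have key : (sigmaX i + sigmaZR i) * sigmaZR i * (sigmaX i + sigmaZR (N := N) i) = (2 : ℝ) • sigmaX i := by
    rw [add_mul, sigmaZR_mul_self, add_mul, one_mul, mul_add, mul_assoc (sigmaX i) (sigmaZR i) (sigmaX i),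
      ← neg_neg (sigmaZR i * sigmaX i), ← sigmaX_mul_sigmaZR_same, mul_neg, ← mul_assoc, sigmaX_mul_sigmaX, one_mul,
      mul_assoc (sigmaX i) (sigmaZR i) (sigmaZR i), sigmaZR_mul_self, mul_one]
    module
  rw [hadOp, smul_mul_assoc, mul_smul_comm, smul_mul_assoc, smul_smul, key, smul_smul, inv_sqrt_two_mul_self,
    inv_mul_cancel₀ two_ne_zero, one_smul]

/-- `U_i` commutes with `σˣ_j`, `j ≠ i`. [folklore] -/
theorem hadOp_mul_sigmaX_of_ne {i j : Fin N} (h : j ≠ i) : hadOp i * sigmaX j = sigmaX j * hadOp (N := N) i := by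
  rw [hadOp, smul_mul_assoc, mul_smul_comm, add_mul, mul_add, sigmaX_comm, ← sigmaX_mul_sigmaZR_of_ne (Ne.symm h)]

/-- `U_i` commutes with `σᶻ_j`, `j ≠ i`. [folklore] -/
theorem hadOp_mul_sigmaZR_of_ne {i j : Fin N} (h : j ≠ i) : hadOp i * sigmaZR j = sigmaZR j * hadOp (N := N) i := by
  rw [hadOp, smul_mul_assoc, mul_smul_comm, add_mul, mul_add, sigmaX_mul_sigmaZR_of_ne h, sigmaZR_comm]

/-- The single-site rotations commute. [folklore] -/
theorem hadOp_commute (i j : Fin N) : Commute (hadOp (N := N) i) (hadOp j) := by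
  by_cases h : j = i
  · rw [h]
  · have hX := hadOp_mul_sigmaX_of_ne (i := j) (j := i) (Ne.symm h)
    have hZ := hadOp_mul_sigmaZR_of_ne (i := j) (j := i) (Ne.symm h)
    change hadOp i * hadOp j = hadOp j * hadOp i
    rw [show hadOp (N := N) i = (Real.sqrt 2)⁻¹ • (sigmaX i + sigmaZR i) from rfl, smul_mul_assoc, mul_smul_comm,
      add_mul, mul_add, hX, hZ]

/-- `U_i` is symmetric. [folklore] -/
theorem hadOp_transpose (i : Fin N) : (hadOp (N := N) i)ᵀ = hadOp i := by
  rw [hadOp, transpose_smul, transpose_add, sigmaZR, diagonal_transpose]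
  congr 2
  ext r r'
  rw [transpose_apply, sigmaX_apply_comm]

/-- **The global Hadamard rotation** `U = ∏_i U_i` (a commuting product). [folklore] -/
def hadU (N : ℕ) : Matrix (Row N) (Row N) ℝ :=
  (univ : Finset (Fin N)).noncommProd hadOp fun i _ j _ _ => hadOp_commute i j

/-- A product of pairwise commuting involutions is an involution. [folklore] -/
theorem noncommProd_mul_self_of_involutive (s : Finset (Fin N)) :
    s.noncommProd hadOp (fun i _ j _ _ => hadOp_commute i j) * s.noncommProd hadOp (fun i _ j _ _ => hadOp_commute i j) =
      (1 : Matrix (Row N) (Row N) ℝ) := by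
  rw [← Finset.noncommProd_mul_distrib hadOp hadOp (fun i _ j _ _ => hadOp_commute i j)
    (fun i _ j _ _ => hadOp_commute i j) (fun i _ j _ _ => hadOp_commute i j)]
  rw [Finset.noncommProd_eq_pow_card s (hadOp * hadOp) _ 1 fun i _ => by rw [Pi.mul_apply, hadOp_mul_self], one_pow]

/-- `U² = 1`. [folklore] -/
theorem hadU_mul_self : hadU N * hadU N = 1 := noncommProd_mul_self_of_involutive univ

/-- `U` is symmetric. [folklore] -/
theorem hadU_transpose : (hadU N)ᵀ = hadU N := by
  unfold hadU
  induction (univ : Finset (Fin N)) using Finset.induction_on with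
  | empty => simp
  | insert a s ha ih =>
    rw [Finset.noncommProd_insert_of_notMem _ _ _ _ ha, transpose_mul, ih, hadOp_transpose]
    exact (Finset.noncommProd_commute s hadOp _ (hadOp a) fun j _ => hadOp_commute a j).eq.symm

/-- **Conjugation rule** `U σˣ_i U = σᶻ_i`. [folklore] -/
theorem hadU_mul_sigmaX_mul_hadU (i : Fin N) : hadU N * sigmaX i * hadU N = sigmaZR i := by
  set U' := (univ.erase i).noncommProd hadOp fun a _ b _ _ => hadOp_commute a b with hU'
  have h1 : hadU N = hadOp i * U' := (Finset.mul_noncommProd_erase univ (mem_univ i) hadOp _).symm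
  have h2 : hadU N = U' * hadOp i := (Finset.noncommProd_erase_mul univ (mem_univ i) hadOp _).symm
  have hX : Commute (sigmaX (N := N) i) U' :=
    Finset.noncommProd_commute _ _ _ _ fun j hj => (hadOp_mul_sigmaX_of_ne (Finset.ne_of_mem_erase hj).symm).symm
  have hUU : U' * U' = 1 := noncommProd_mul_self_of_involutive _
  calc hadU N * sigmaX i * hadU N = hadOp i * U' * sigmaX i * (U' * hadOp i) := by rw [← h1, ← h2]
    _ = hadOp i * (sigmaX i * U') * (U' * hadOp i) := by rw [mul_assoc (hadOp i) U' (sigmaX i), ← hX.eq]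
    _ = hadOp i * sigmaX i * (U' * U') * hadOp i := by simp only [mul_assoc]
    _ = sigmaZR i := by rw [hUU, mul_one, hadOp_mul_sigmaX_mul_hadOp]

/-- **Conjugation rule** `U σᶻ_i U = σˣ_i`. [folklore] -/
theorem hadU_mul_sigmaZR_mul_hadU (i : Fin N) : hadU N * sigmaZR i * hadU N = sigmaX i := by
  set U' := (univ.erase i).noncommProd hadOp fun a _ b _ _ => hadOp_commute a b with hU'
  have h1 : hadU N = hadOp i * U' := (Finset.mul_noncommProd_erase univ (mem_univ i) hadOp _).symm
  have h2 : hadU N = U' * hadOp i := (Finset.noncommProd_erase_mul univ (mem_univ i) hadOp _).symm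
  have hZ : Commute (sigmaZR (N := N) i) U' :=
    Finset.noncommProd_commute _ _ _ _ fun j hj => (hadOp_mul_sigmaZR_of_ne (Finset.ne_of_mem_erase hj).symm).symm
  have hUU : U' * U' = 1 := noncommProd_mul_self_of_involutive _
  calc hadU N * sigmaZR i * hadU N = hadOp i * U' * sigmaZR i * (U' * hadOp i) := by rw [← h1, ← h2]
    _ = hadOp i * (sigmaZR i * U') * (U' * hadOp i) := by rw [mul_assoc (hadOp i) U' (sigmaZR i), ← hZ.eq]
    _ = hadOp i * sigmaZR i * (U' * U') * hadOp i := by simp only [mul_assoc]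
    _ = sigmaX i := by rw [hUU, mul_one, hadOp_mul_sigmaZR_mul_hadOp]

/-- Conjugation of a bond: `U σᶻ_iσᶻ_j U = σˣ_iσˣ_j`. [folklore] -/
theorem hadU_mul_sigmaZR_mul_sigmaZR_mul_hadU (i j : Fin N) :
    hadU N * (sigmaZR i * sigmaZR j) * hadU N = sigmaX i * sigmaX j := by
  calc hadU N * (sigmaZR i * sigmaZR j) * hadU N = (hadU N * sigmaZR i * hadU N) * (hadU N * sigmaZR j * hadU N) := by
        simp only [mul_assoc]; rw [← mul_assoc (hadU N) (hadU N), hadU_mul_self, one_mul]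
    _ = sigmaX i * sigmaX j := by rw [hadU_mul_sigmaZR_mul_hadU, hadU_mul_sigmaZR_mul_hadU]

variable [NeZero N]

variable (N) in
/-- The chain in the ROTATED picture, shifted by `N`: `S'_c = N·1 + ∑_i τ^c_i σˣ_iσˣ_{i+1} + h ∑_i σᶻ_i`
— the conjugate `U (N·1 - H_c) U` (`hadU_conj_shift_tfiHamTw`); its bond part is an entrywise
NONNEGATIVE matrix signed by the twist, its field part is diagonal. [folklore] -/
def tfiHamX (h c : ℝ) : Matrix (Row N) (Row N) ℝ :=
  (N : ℝ) • (1 : Matrix (Row N) (Row N) ℝ) + ∑ i, twistAt N c i • (sigmaX i * sigmaX (i + 1)) + h • ∑ i, sigmaZR i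

/-- The twisted energy as a weighted sum of bonds: `diag(H_c(r)) = ∑_i τ^c_i σᶻ_iσᶻ_{i+1}`. [folklore] -/
theorem diagonal_rowEnergyTw (c : ℝ) :
    diagonal (rowEnergyTw N c) = ∑ i, twistAt N c i • (sigmaZR i * sigmaZR (N := N) (i + 1)) := by
  have hterm : ∀ i : Fin N, twistAt N c i • (sigmaZR i * sigmaZR (N := N) (i + 1)) =
      diagonal fun r => twistAt N c i * (spinAt i r * spinAt (i + 1) r) := by
    intro i
    rw [sigmaZR, sigmaZR, diagonal_mul_diagonal, ← diagonal_smul]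
    rfl
  simp only [hterm]
  ext r r'
  simp only [Matrix.sum_apply, diagonal_apply]
  split_ifs with hrr
  · rfl
  · simp

/-- **`U (N·1 - H_c) U = S'_c`**: in the rotated picture the Ising bonds are the flip operators
`σˣ_iσˣ_{i+1}` and the transverse field is diagonal. [folklore] -/
theorem hadU_conj_shift_tfiHamTw (h c : ℝ) :
    hadU N * ((N : ℝ) • (1 : Matrix (Row N) (Row N) ℝ) - tfiHamTw N h c) * hadU N = tfiHamX N h c := by
  rw [tfiHamTw, diagonal_rowEnergyTw, tfiHamX, sub_sub_eq_add_sub, sub_neg_eq_add]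
  simp only [mul_add, add_mul, mul_smul_comm, smul_mul_assoc, Finset.mul_sum, Finset.sum_mul, mul_one, hadU_mul_self,
    hadU_mul_sigmaZR_mul_sigmaZR_mul_hadU, hadU_mul_sigmaX_mul_hadU]
  abel

/-- The inverse conjugation: `U S'_c U = N·1 - H_c`. [folklore] -/
theorem hadU_conj_tfiHamX (h c : ℝ) :
    hadU N * tfiHamX N h c * hadU N = (N : ℝ) • (1 : Matrix (Row N) (Row N) ℝ) - tfiHamTw N h c := by
  rw [← hadU_conj_shift_tfiHamTw h c]
  simp only [← mul_assoc, hadU_mul_self, one_mul]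
  simp only [mul_assoc, hadU_mul_self, mul_one]

omit [NeZero N] in
/-- `(σˣ_i v)(r) = v(flip_i r)`. [folklore] -/
theorem sigmaX_mulVec_apply (i : Fin N) (v : Row N → ℝ) (r : Row N) : (sigmaX i *ᵥ v) r = v (Row.flipAt i r) := by
  rw [mulVec, dotProduct, Finset.sum_eq_single (Row.flipAt i r)]
  · rw [sigmaX_apply, if_pos rfl, one_mul]
  · intro b _ hb; rw [sigmaX_apply, if_neg hb, zero_mul]
  · intro h'; exact absurd (mem_univ _) h'

omit [NeZero N] in
/-- The quadratic form of a double flip: `vᵀ σˣ_iσˣ_j v = ∑_r v(r) v(flip_j flip_i r)`. [folklore] -/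
theorem dotProduct_sigmaX_mul_sigmaX_mulVec (i j : Fin N) (v : Row N → ℝ) :
    v ⬝ᵥ ((sigmaX i * sigmaX j) *ᵥ v) = ∑ r, v r * v (Row.flipAt j (Row.flipAt i r)) := by
  rw [← mulVec_mulVec, dotProduct]
  refine Finset.sum_congr rfl fun r _ => ?_
  rw [sigmaX_mulVec_apply, sigmaX_mulVec_apply]

omit [NeZero N] in
/-- The quadratic form of the field part: `vᵀ (∑ σᶻ_i) v = ∑_r (∑_i r_i) v(r)²` — insensitive to the
signs of `v`. [folklore] -/
theorem dotProduct_sum_sigmaZR_mulVec (v : Row N → ℝ) :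
    v ⬝ᵥ ((∑ i, sigmaZR i) *ᵥ v) = ∑ r, (∑ i, spinAt i r) * (v r * v r) := by
  have hsum : (∑ i, sigmaZR (N := N) i) = diagonal fun r => ∑ i, spinAt i r := by
    ext r r'
    simp only [Matrix.sum_apply, sigmaZR, diagonal_apply]
    split_ifs with hrr
    · rfl
    · simp
  rw [hsum, dotProduct]
  refine Finset.sum_congr rfl fun r _ => ?_
  rw [mulVec_diagonal]
  ring

/-- **Domination in the rotated picture**: `vᵀ S'_{-1} v ≤ |v|ᵀ S'_1 |v|` — the bond terms are
`± ∑_r v(r) v(r'')` with `|∑ v(r)v(r'')| ≤ ∑ |v(r)||v(r'')|`, the diagonal terms are equal. [cite: DingZhou2009, §2.1, Theorem 2.1 (the Rayleigh quotient with absolute values)] -/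
theorem dotProduct_tfiHamX_twisted_le (h : ℝ) (v : Row N → ℝ) :
    v ⬝ᵥ (tfiHamX N h (-1) *ᵥ v) ≤ (fun r => |v r|) ⬝ᵥ (tfiHamX N h 1 *ᵥ fun r => |v r|) := by
  have expand : ∀ (c : ℝ) (w : Row N → ℝ), w ⬝ᵥ (tfiHamX N h c *ᵥ w) =
      (N : ℝ) * (w ⬝ᵥ w) + ∑ i, twistAt N c i * ∑ r, w r * w (Row.flipAt (i + 1) (Row.flipAt i r)) +
        h * ∑ r, (∑ i, spinAt i r) * (w r * w r) := by
    intro c w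
    rw [tfiHamX, add_mulVec, add_mulVec, smul_mulVec, one_mulVec, sum_mulVec, smul_mulVec, dotProduct_add,
      dotProduct_add, dotProduct_smul, dotProduct_sum, dotProduct_smul, dotProduct_sum_sigmaZR_mulVec, smul_eq_mul,
      smul_eq_mul]
    congr 2
    refine Finset.sum_congr rfl fun i _ => ?_
    rw [smul_mulVec, dotProduct_smul, dotProduct_sigmaX_mul_sigmaX_mulVec, smul_eq_mul]
  rw [expand, expand]
  have habs : (fun r => |v r|) ⬝ᵥ (fun r => |v r|) = v ⬝ᵥ v := by
    simp only [dotProduct, ← abs_mul, abs_mul_self]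
  have hsq : ∀ r : Row N, |v r| * |v r| = v r * v r := fun r => by rw [← abs_mul, abs_mul_self]
  simp only [habs, hsq]
  refine add_le_add (add_le_add le_rfl (Finset.sum_le_sum fun i _ => ?_)) le_rfl
  have htw : twistAt N 1 i = 1 := by unfold twistAt; split_ifs <;> rfl
  rw [htw, one_mul]
  calc twistAt N (-1) i * ∑ r, v r * v (Row.flipAt (i + 1) (Row.flipAt i r))
      ≤ |twistAt N (-1) i * ∑ r, v r * v (Row.flipAt (i + 1) (Row.flipAt i r))| := le_abs_self _
    _ = |∑ r, v r * v (Row.flipAt (i + 1) (Row.flipAt i r))| := by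
        rw [abs_mul]; unfold twistAt; split_ifs <;> simp
    _ ≤ ∑ r, |v r * v (Row.flipAt (i + 1) (Row.flipAt i r))| := Finset.abs_sum_le_sum_abs _ _
    _ = ∑ r, |v r| * |v (Row.flipAt (i + 1) (Row.flipAt i r))| := Finset.sum_congr rfl fun r _ => abs_mul _ _

omit [NeZero N] in
/-- `xᵀ U M U y = (Ux)ᵀ M (Uy)` for the symmetric `U`. [folklore] -/
theorem dotProduct_hadU_conj_mulVec (M : Matrix (Row N) (Row N) ℝ) (x y : Row N → ℝ) :
    x ⬝ᵥ ((hadU N * M * hadU N) *ᵥ y) = (hadU N *ᵥ x) ⬝ᵥ (M *ᵥ (hadU N *ᵥ y)) := by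
  rw [← mulVec_mulVec, ← mulVec_mulVec, dotProduct_mulVec, ← mulVec_transpose, hadU_transpose]

omit [NeZero N] in
/-- `‖Ux‖² = ‖x‖²`. [folklore] -/
theorem dotProduct_hadU_mulVec_self (x : Row N → ℝ) : (hadU N *ᵥ x) ⬝ᵥ (hadU N *ᵥ x) = x ⬝ᵥ x := by
  rw [dotProduct_mulVec, ← mulVec_transpose, hadU_transpose, mulVec_mulVec, hadU_mul_self, one_mulVec]

omit [NeZero N] in
/-- **The largest eigenvalue does not decrease under the Hadamard conjugation** (in fact it is
invariant; one direction suffices): `λ_max(M) ≤ λ_max(U M U)`. [folklore] -/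
theorem topEigenvalue_le_hadU_conj {M : Matrix (Row N) (Row N) ℝ} (hM : M.IsHermitian)
    (hM' : (hadU N * M * hadU N).IsHermitian) : topEigenvalue hM ≤ topEigenvalue hM' := by
  obtain ⟨i₀, hi₀⟩ := exists_eigenvalues_eq_topEigenvalue hM
  set b : Row N → ℝ := (hM.eigenvectorBasis i₀).ofLp with hb
  have hMb : M *ᵥ b = topEigenvalue hM • b := by rw [hb, hM.mulVec_eigenvectorBasis i₀, hi₀]
  have hbb : b ⬝ᵥ b = 1 := by rw [hb, eigenvectorBasis_dotProduct hM i₀ i₀, if_pos rfl]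
  -- Rayleigh quotient of `U b` for `U M U`
  have hR := dotProduct_mulVec_le hM' (hadU N *ᵥ b)
  rw [dotProduct_hadU_conj_mulVec, mulVec_mulVec, hadU_mul_self, one_mulVec, hMb, dotProduct_smul,
    dotProduct_hadU_mulVec_self, hbb, smul_eq_mul, mul_one, mul_one] at hR
  exact hR

omit [NeZero N] in
/-- A Hadamard conjugate of a symmetric matrix is symmetric. [folklore] -/
theorem isHermitian_hadU_conj {M : Matrix (Row N) (Row N) ℝ} (hM : M.IsHermitian) :
    (hadU N * M * hadU N).IsHermitian := by
  have h := Matrix.isHermitian_mul_mul_conjTranspose (hadU N) hM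
  rwa [conjTranspose_eq_transpose_of_trivial, hadU_transpose] at h

/-- The shifted chain `N·1 - H_c` is symmetric. [folklore] -/
theorem shift_tfiHamTw_isHermitian (h c : ℝ) :
    ((N : ℝ) • (1 : Matrix (Row N) (Row N) ℝ) - tfiHamTw N h c).IsHermitian := by
  have h1 : ((N : ℝ) • (1 : Matrix (Row N) (Row N) ℝ)).IsHermitian := by
    rw [Matrix.IsHermitian, conjTranspose_smul, conjTranspose_one]; rfl
  exact h1.sub (tfiHamTw_isHermitian h c)

/-- `S'_c` is symmetric. [folklore] -/
theorem tfiHamX_isHermitian (h c : ℝ) : (tfiHamX N h c).IsHermitian := by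
  rw [← hadU_conj_shift_tfiHamTw]
  exact isHermitian_hadU_conj (shift_tfiHamTw_isHermitian h c)

/-- **The diamagnetic inequality** (frustrating one bond does not lower the ground-state energy of
the ferromagnetic transverse-field Ising ring): `λ_max(N·1 - H_{-1}) ≤ λ_max(N·1 - H_1)`. Proof:
conjugate into the rotated picture, compare Rayleigh quotients with absolute values
(`dotProduct_tfiHamX_twisted_le`), conjugate back. [cite: DingZhou2009, §2.1, Theorem 2.1 (the Rayleigh quotient with absolute values)] -/
theorem topEigenvalue_shift_twisted_le (h : ℝ) :
    topEigenvalue (shift_tfiHamTw_isHermitian (N := N) h (-1)) ≤ topEigenvalue (shift_tfiHamTw_isHermitian (N := N) h 1) := by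
  have hX1 := tfiHamX_isHermitian (N := N) h 1
  have hXm := tfiHamX_isHermitian (N := N) h (-1)
  -- step 1: into the rotated picture
  have s1 : topEigenvalue (shift_tfiHamTw_isHermitian (N := N) h (-1)) ≤ topEigenvalue hXm := by
    have := topEigenvalue_le_hadU_conj (shift_tfiHamTw_isHermitian (N := N) h (-1))
      (isHermitian_hadU_conj (shift_tfiHamTw_isHermitian h (-1)))
    convert this using 2; rw [hadU_conj_shift_tfiHamTw]
  -- step 2: domination of Rayleigh quotients
  have s2 : topEigenvalue hXm ≤ topEigenvalue hX1 := by
    obtain ⟨i₀, hi₀⟩ := exists_eigenvalues_eq_topEigenvalue hXm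
    set b : Row N → ℝ := (hXm.eigenvectorBasis i₀).ofLp with hb
    have hMb : tfiHamX N h (-1) *ᵥ b = topEigenvalue hXm • b := by rw [hb, hXm.mulVec_eigenvectorBasis i₀, hi₀]
    have hbb : b ⬝ᵥ b = 1 := by rw [hb, eigenvectorBasis_dotProduct hXm i₀ i₀, if_pos rfl]
    have habs : (fun r => |b r|) ⬝ᵥ (fun r => |b r|) = 1 := by
      rw [← hbb]; simp only [dotProduct, ← abs_mul, abs_mul_self]
    have h1 : b ⬝ᵥ (tfiHamX N h (-1) *ᵥ b) = topEigenvalue hXm := by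
      rw [hMb, dotProduct_smul, hbb, smul_eq_mul, mul_one]
    have h2 := dotProduct_tfiHamX_twisted_le h b
    have h3 := dotProduct_mulVec_le hX1 (fun r => |b r|)
    rw [habs, mul_one] at h3
    linarith
  -- step 3: back
  have s3 : topEigenvalue hX1 ≤ topEigenvalue (shift_tfiHamTw_isHermitian (N := N) h 1) := by
    have := topEigenvalue_le_hadU_conj hX1 (isHermitian_hadU_conj hX1)
    convert this using 2; rw [hadU_conj_tfiHamX]
  exact s1.trans (s2.trans s3)

end Hadamard

/-! ### Part B. The Perron vector of `T₂`: parity, the chain eigenvalue, and its extremality -/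

section Perron

variable [NeZero N]

/-- The flipped vector `r ↦ v(-r)` of an eigenvector of `T₂` is an eigenvector with the same
eigenvalue (`T₂(-r,-r') = T₂(r,r')`). [folklore] -/
theorem diagTwoLayer_mulVec_comp_neg (β : ℝ) {v : Row N → ℝ} {c : ℝ} (hv : diagTwoLayer N β *ᵥ v = c • v) :
    diagTwoLayer N β *ᵥ (fun r => v (-r)) = c • fun r => v (-r) := by
  funext r
  have h := congr_fun hv (-r)
  simp only [mulVec, dotProduct, Pi.smul_apply, smul_eq_mul] at h ⊢
  rw [← h, ← Equiv.sum_comp (Equiv.neg (Row N))]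
  refine sum_congr rfl fun r' _ => ?_
  rw [Equiv.neg_apply, ← diagTwoLayer_neg_neg β r (-r'), neg_neg]

/-- **The Perron vector of `T₂` is flip-invariant**: `ψ > 0`, `T₂ψ = λ_max ψ` imply `ψ(-r) = ψ(r)`. [cite: SchultzMattisLieb1964, §IV (the maximal eigenvector lies in the even sector)] -/
theorem diagPerron_flip_invariant {β : ℝ} {Ω : Row N → ℝ} (hΩ : ∀ r, 0 < Ω r)
    (hAΩ : diagTwoLayer N β *ᵥ Ω = topEigenvalue (diagTwoLayer_isHermitian (N := N) β) • Ω) (r : Row N) :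
    Ω (-r) = Ω r := by
  have hflip := diagTwoLayer_mulVec_comp_neg β hAΩ
  obtain ⟨c, hc⟩ := eq_smul_of_mulVec_eq_topEigenvalue (diagTwoLayer_isHermitian (N := N) β)
    (diagTwoLayer_apply_pos β) hΩ hAΩ hflip
  have h1 : Ω (-r) = c * Ω r := by simpa using congr_fun hc r
  have h2 : Ω r = c * Ω (-r) := by simpa using congr_fun hc (-r)
  have hc2 : c * c = 1 := by
    have := hΩ r
    have h3 : Ω r = c * c * Ω r := by rw [mul_assoc, ← h1, ← h2]
    field_simp at h3
    linarith
  have hcpos : 0 < c := by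
    have := hΩ (-r); rw [h1] at this
    exact pos_of_mul_pos_left this (hΩ r).le
  have hc1 : c = 1 := by nlinarith
  rw [h1, hc1, one_mul]

/-- **The complexified Perron vector is EVEN**: `P ψ_ℂ = ψ_ℂ`. [cite: SchultzMattisLieb1964, §IV] -/
theorem jwString_univ_mulVec_diagPerron {β : ℝ} {Ω : Row N → ℝ} (hΩ : ∀ r, 0 < Ω r)
    (hAΩ : diagTwoLayer N β *ᵥ Ω = topEigenvalue (diagTwoLayer_isHermitian (N := N) β) • Ω) :
    jwString (univ : Finset (Fin N)) *ᵥ (fun r => (Ω r : ℂ)) = ((1 : ℝ) : ℂ) • fun r => (Ω r : ℂ) := by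
  funext r
  rw [jwString_univ_mulVec_apply, diagPerron_flip_invariant hΩ hAΩ r, Pi.smul_apply, Complex.ofReal_one, one_smul]

/-- **The Perron vector of `T₂` is an eigenvector of the commuting chain**: for `β ≠ 0` there is
`μ` with `H ψ = μ ψ`, `H = tfiHam N (sinh 2β)⁻²` (`T₂ (Hψ) = H (T₂ψ) = λ_max Hψ` and the top
eigenspace is the line of `ψ`). [cite: SuzukiPTP1971, abstract and main theorem (2D Ising transfer matrix vs. quantum chain in a field)] -/
theorem exists_tfiHam_mulVec_diagPerron {β : ℝ} (hβ : β ≠ 0) {Ω : Row N → ℝ} (hΩ : ∀ r, 0 < Ω r)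
    (hAΩ : diagTwoLayer N β *ᵥ Ω = topEigenvalue (diagTwoLayer_isHermitian (N := N) β) • Ω) :
    ∃ μ : ℝ, tfiHam N (diagField β) *ᵥ Ω = μ • Ω := by
  have hcomm := diagTwoLayer_mul_tfiHam (N := N) hβ
  have hev : diagTwoLayer N β *ᵥ (tfiHam N (diagField β) *ᵥ Ω) =
      topEigenvalue (diagTwoLayer_isHermitian (N := N) β) • (tfiHam N (diagField β) *ᵥ Ω) := by
    rw [mulVec_mulVec, hcomm, ← mulVec_mulVec, hAΩ, mulVec_smul]
  obtain ⟨c, hc⟩ := eq_smul_of_mulVec_eq_topEigenvalue (diagTwoLayer_isHermitian (N := N) β)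
    (diagTwoLayer_apply_pos β) hΩ hAΩ hev
  exact ⟨c, hc⟩

/-- `tfiHam` is the untwisted `tfiHamTw` (`ringEnergy = rowEnergyTw 1`). [folklore] -/
theorem tfiHam_eq_tfiHamTw_one (h : ℝ) : tfiHam N h = tfiHamTw N h 1 := by
  have hE : ringEnergy (N := N) = rowEnergyTw N 1 := by
    funext r
    simp only [ringEnergy, rowEnergyTw, twistAt, ite_self, one_mul]
  rw [tfiHam, tfiHamTw, flipSum, hE]

/-- The shifted chain `N·1 - H` has NONNEGATIVE entries for `h ≥ 0` (`|E(r)| ≤ N` on the diagonal,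
`h` on single flips, `0` elsewhere). [folklore] -/
theorem shift_tfiHam_apply_nonneg {h : ℝ} (hh : 0 ≤ h) (r r' : Row N) :
    0 ≤ ((N : ℝ) • (1 : Matrix (Row N) (Row N) ℝ) - tfiHam N h) r r' := by
  rw [Matrix.sub_apply, Matrix.smul_apply, tfiHam_apply, diagonal_apply, Matrix.one_apply, smul_eq_mul]
  have hX : 0 ≤ ∑ i, sigmaX (N := N) i r r' := Finset.sum_nonneg fun i _ => by
    rw [sigmaX_apply]; split_ifs <;> norm_num
  by_cases hrr : r = r'
  · subst hrr
    rw [if_pos rfl, if_pos rfl, mul_one]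
    have hE : |ringEnergy r| ≤ N := by
      unfold ringEnergy
      calc |∑ i, spinAt i r * spinAt (i + 1) r| ≤ ∑ i : Fin N, |spinAt i r * spinAt (i + 1) r| := Finset.abs_sum_le_sum_abs _ _
        _ = ∑ _i : Fin N, (1 : ℝ) := Finset.sum_congr rfl fun i _ => by rw [abs_mul, abs_spinAt, abs_spinAt, mul_one]
        _ = N := by simp
    have := neg_abs_le (ringEnergy r)
    nlinarith [abs_nonneg (ringEnergy r)]
  · simp only [if_neg hrr, mul_zero, neg_zero, zero_sub, neg_neg]
    exact mul_nonneg hh hX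

/-- **`μ` is the bottom of the spectrum of `H`**: if `ψ > 0` and `Hψ = μψ` then
`λ_max(N·1 - H) = N - μ` (`h ≥ 0`). Proof: a top eigenvector `x` of the entrywise nonnegative
`S = N·1 - H` may be replaced by `|x|` (Rayleigh with absolute values, equality case), and
`(N - μ)⟨|x|, ψ⟩ = ⟨|x|, Sψ⟩ = ⟨S|x|, ψ⟩ = λ_max ⟨|x|, ψ⟩` with `⟨|x|, ψ⟩ > 0`. [cite: DingZhou2009, §2.1, Theorem 2.1 (iii) (a nonnegative eigenvector belongs to r(A))] -/
theorem topEigenvalue_shift_tfiHam_eq {h : ℝ} (hh : 0 ≤ h) {Ω : Row N → ℝ} (hΩ : ∀ r, 0 < Ω r) {μ : ℝ}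
    (hHΩ : tfiHam N h *ᵥ Ω = μ • Ω) :
    topEigenvalue (shift_tfiHamTw_isHermitian (N := N) h 1) = N - μ := by
  set S : Matrix (Row N) (Row N) ℝ := (N : ℝ) • (1 : Matrix (Row N) (Row N) ℝ) - tfiHamTw N h 1 with hS
  have hSH : S = (N : ℝ) • (1 : Matrix (Row N) (Row N) ℝ) - tfiHam N h := by rw [hS, tfiHam_eq_tfiHamTw_one]
  have hSherm : S.IsHermitian := shift_tfiHamTw_isHermitian h 1
  have hS0 : ∀ r r', 0 ≤ S r r' := fun r r' => by rw [hSH]; exact shift_tfiHam_apply_nonneg hh r r'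
  -- `S ψ = (N - μ) ψ`
  have hSΩ : S *ᵥ Ω = ((N : ℝ) - μ) • Ω := by
    rw [hSH, sub_mulVec, smul_mulVec, one_mulVec, hHΩ, sub_smul]
  -- a nonnegative top eigenvector `a = |x|`
  obtain ⟨i₀, hi₀⟩ := exists_eigenvalues_eq_topEigenvalue hSherm
  set x : Row N → ℝ := (hSherm.eigenvectorBasis i₀).ofLp with hx
  have hSx : S *ᵥ x = topEigenvalue hSherm • x := by rw [hx, hSherm.mulVec_eigenvectorBasis i₀, hi₀]
  have hxx : x ⬝ᵥ x = 1 := by rw [hx, eigenvectorBasis_dotProduct hSherm i₀ i₀, if_pos rfl]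
  set a : Row N → ℝ := fun r => |x r| with ha
  have haa : a ⬝ᵥ a = 1 := by rw [← hxx]; simp only [ha, dotProduct, ← abs_mul, abs_mul_self]
  have hRa : a ⬝ᵥ (S *ᵥ a) = topEigenvalue hSherm * (a ⬝ᵥ a) := by
    refine le_antisymm (dotProduct_mulVec_le hSherm a) ?_
    have h1 : x ⬝ᵥ (S *ᵥ x) = topEigenvalue hSherm := by rw [hSx, dotProduct_smul, hxx, smul_eq_mul, mul_one]
    have h2 := dotProduct_mulVec_le_abs hS0 x
    rw [haa, mul_one, ← h1]
    exact h2
  have hSa : S *ᵥ a = topEigenvalue hSherm • a := mulVec_eq_smul_of_dotProduct_eq hSherm hRa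
  -- `⟨a, ψ⟩ > 0`
  have hpos : 0 < a ⬝ᵥ Ω := by
    obtain ⟨r₀, hr₀⟩ : ∃ r, x r ≠ 0 := by
      by_contra hall
      push Not at hall
      have : x ⬝ᵥ x = 0 := by simp [dotProduct, hall]
      rw [hxx] at this
      exact one_ne_zero this
    rw [dotProduct]
    refine lt_of_lt_of_le (mul_pos (abs_pos.2 hr₀) (hΩ r₀)) ?_
    exact Finset.single_le_sum (f := fun r => a r * Ω r) (fun r _ => mul_nonneg (abs_nonneg _) (hΩ r).le) (mem_univ r₀)
  -- symmetry of `S`: `⟨a, Sψ⟩ = ⟨Sa, ψ⟩`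
  have hsym : a ⬝ᵥ (S *ᵥ Ω) = (S *ᵥ a) ⬝ᵥ Ω := by
    have hT : Sᵀ = S := by
      have := hSherm
      rwa [Matrix.IsHermitian, conjTranspose_eq_transpose_of_trivial] at this
    rw [dotProduct_mulVec, ← mulVec_transpose, hT]
  rw [hSΩ, hSa, dotProduct_smul, smul_dotProduct, smul_eq_mul, smul_eq_mul] at hsym
  exact (mul_right_cancel₀ hpos.ne' hsym).symm

end Perron

/-! ### Part C. The lowering modes annihilate the Perron vector at the critical point -/

section Vacuum

variable [NeZero N]

/-- `β_c(2) ≠ 0`. [folklore] -/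
theorem criticalBetaTwo_ne_zero : criticalBetaTwo ≠ 0 := criticalBetaTwo_pos.ne'

/-- **The lowering modes annihilate the Perron vector of the critical diagonal transfer matrix**
(the SML §IV mechanism with Suzuki's commuting Hamiltonian): at `β = β_c(2)`, for the Perron vector
`ψ > 0` of `T₂` and every antiperiodic momentum `q_m`, `Γ(w_{q_m}) ψ_ℂ = 0`. Proof: `ψ` is even and
`Hψ = μψ` with `λ_max(N - H) = N - μ`; on even vectors `H = H⁺ = tfiBil N 1 1`, and
`[H⁺, Γ(w)] = -ε Γ(w)` gives `H⁺φ = (μ - ε)φ` for `φ = Γ(w)ψ_ℂ`, which is ODD, where `H⁺ = H₋`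
(one antiferromagnetic bond): so `(N - H₋)φ = (N - μ + ε)φ`, and if `φ ≠ 0` then
`N - μ + ε ≤ λ_max(N - H₋) ≤ λ_max(N - H) = N - μ`, contradicting `ε = 4 sin(q_m/2) > 0`. [cite: SchultzMattisLieb1964, §IV (the maximal eigenvector is the vacuum of the fermion modes)] -/
theorem fieldOp_tfiLow_mulVec_diagPerron {Ω : Row N → ℝ} (hΩ : ∀ r, 0 < Ω r)
    (hAΩ : diagTwoLayer N criticalBetaTwo *ᵥ Ω =
      topEigenvalue (diagTwoLayer_isHermitian (N := N) criticalBetaTwo) • Ω) (m : Fin N) :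
    fieldOp (isingMajorana N) (tfiLow N (apMom N m)) *ᵥ (fun r => (Ω r : ℂ)) = 0 := by
  set ΩC : Row N → ℂ := fun r => (Ω r : ℂ) with hΩC
  set q := apMom N m with hq
  set ε : ℝ := tfiEps q with hε
  set F := fieldOp (isingMajorana N) (tfiLow N q) with hF
  set v := F *ᵥ ΩC with hvdef
  have hεpos : 0 < ε := tfiEps_apMom_pos m
  -- the chain eigenvalue `μ` and its extremality
  obtain ⟨μ, hHΩ⟩ := exists_tfiHam_mulVec_diagPerron criticalBetaTwo_ne_zero hΩ hAΩ
  rw [diagField_criticalBetaTwo] at hHΩ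
  have htop : topEigenvalue (shift_tfiHamTw_isHermitian (N := N) 1 1) = N - μ :=
    topEigenvalue_shift_tfiHam_eq zero_le_one hΩ hHΩ
  -- `ψ_ℂ` is even and `H⁺ ψ_ℂ = μ ψ_ℂ`
  have hPΩ : jwString (univ : Finset (Fin N)) *ᵥ ΩC = ((1 : ℝ) : ℂ) • ΩC := jwString_univ_mulVec_diagPerron hΩ hAΩ
  have hHΩ' : tfiHamTw N 1 1 *ᵥ Ω = μ • Ω := by rw [← tfiHam_eq_tfiHamTw_one]; exact hHΩ
  have hHC : (tfiHamTw N 1 1).map (algebraMap ℝ ℂ) *ᵥ ΩC = (μ : ℂ) • ΩC := by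
    funext r
    have := RingHom.map_mulVec (algebraMap ℝ ℂ) (tfiHamTw N 1 1) Ω r
    rw [hHΩ'] at this
    rw [← show ((algebraMap ℝ ℂ) ∘ Ω) = ΩC from rfl, ← this]
    simp [Algebra.algebraMap_eq_smul_one]
  have hBΩ : tfiBil N 1 1 *ᵥ ΩC = (μ : ℂ) • ΩC := by
    rw [← Complex.ofReal_one, ← tfiHamTw_one_map_mulVec_of_parity 1 hPΩ, hHC]
  -- `H⁺ v = (μ - ε) v`
  have hcomm := tfiBil_commutator_fieldOp (N := N) 1 1 (tfiLow N q)
  rw [tfiGen_tfiLow (exp_apMom_mul_N m), fieldOp_smul, ← hF] at hcomm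
  have hBv : tfiBil N 1 1 *ᵥ v = ((μ - ε : ℝ) : ℂ) • v := by
    have h1 : tfiBil N 1 1 * F = F * tfiBil N 1 1 + -((ε : ℝ) : ℂ) • F := by
      rw [← hcomm]; abel
    rw [hvdef, mulVec_mulVec, h1, add_mulVec, smul_mulVec, ← mulVec_mulVec, hBΩ, mulVec_smul, ← add_smul,
      Complex.ofReal_sub, sub_eq_add_neg]
  -- `v` is odd, so `H⁺ v = H₋ v`
  have hPv : jwString (univ : Finset (Fin N)) *ᵥ v = ((-1 : ℝ) : ℂ) • v := by
    rw [hvdef, mulVec_mulVec, jwString_univ_mul_fieldOp, neg_mulVec, ← mulVec_mulVec, hPΩ, mulVec_smul,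
      Complex.ofReal_one, one_smul, Complex.ofReal_neg, Complex.ofReal_one, neg_one_smul]
  have hHv : (tfiHamTw N 1 (-1)).map (algebraMap ℝ ℂ) *ᵥ v = ((μ - ε : ℝ) : ℂ) • v := by
    rw [← tfiBil_one_mulVec_of_odd 1 hPv, hBv]
  -- the shifted form `(N - H₋) v = (N - μ + ε) v`
  have hmap : ((N : ℝ) • (1 : Matrix (Row N) (Row N) ℝ) - tfiHamTw N 1 (-1)).map (algebraMap ℝ ℂ) =
      ((N : ℝ) : ℂ) • (1 : Matrix (Row N) (Row N) ℂ) - (tfiHamTw N 1 (-1)).map (algebraMap ℝ ℂ) := by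
    ext r r'
    simp only [Matrix.map_apply, Matrix.sub_apply, Matrix.smul_apply, Matrix.one_apply, smul_eq_mul, mul_ite, mul_one,
      mul_zero, Complex.coe_algebraMap, Complex.ofReal_sub, apply_ite Complex.ofReal, Complex.ofReal_zero]
  have hSv : ((N : ℝ) • (1 : Matrix (Row N) (Row N) ℝ) - tfiHamTw N 1 (-1)).map (algebraMap ℝ ℂ) *ᵥ v =
      (((N : ℝ) - (μ - ε) : ℝ) : ℂ) • v := by
    rw [hmap, sub_mulVec, smul_mulVec, one_mulVec, hHv, ← sub_smul, ← Complex.ofReal_sub]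
  -- if `v ≠ 0`, `N - μ + ε ≤ λ_max(N - H₋) ≤ λ_max(N - H) = N - μ`, contradicting `ε > 0`
  by_contra hv
  have h1 := le_topEigenvalue_of_map_mulVec (shift_tfiHamTw_isHermitian (N := N) 1 (-1)) hv hSv
  have h2 := topEigenvalue_shift_twisted_le (N := N) (1 : ℝ)
  rw [htop] at h2
  linarith

/-- **The Perron vector of the critical diagonal transfer matrix is a polarized (Fock) vacuum** for
the Ising Majorana family, with the lowering space `tfiLowSpace N` and the polarization `tfiPol N` of
the critical transverse-field Ising chain (Suzuki 1971 + Pfeuty 1970 + SML 1964, §IV; so Wick's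
theorem `expect_prodPairs_div` computes `⟨ψ, · ψ⟩`). [cite: SchultzMattisLieb1964, §IV (the maximal eigenvector is the vacuum of the fermion modes)] -/
theorem isPolarizedVacuum_diagPerron {Ω : Row N → ℝ} (hΩ : ∀ r, 0 < Ω r)
    (hAΩ : diagTwoLayer N criticalBetaTwo *ᵥ Ω =
      topEigenvalue (diagTwoLayer_isHermitian (N := N) criticalBetaTwo) • Ω) :
    IsPolarizedVacuum (isingMajorana N) (tfiLowSpace N) (tfiPol N) (fun r => (Ω r : ℂ)) where
  annihilates := by
    refine fieldOp_mulVec_eq_zero_of_span (isingMajorana N) _ fun w hw => ?_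
    obtain ⟨m, rfl⟩ := hw
    exact fieldOp_tfiLow_mulVec_diagPerron hΩ hAΩ m
  map_mem := tfiPol_mem
  star_sub_mem := star_sub_tfiPol_mem

/-- **Existence form**: for every `N ≥ 1` the critical two-layer diagonal transfer matrix `T₂` has a
positive top eigenvector which is a polarized vacuum of the critical chain's lowering modes — the
diagonal cylinder state of the critical planar Ising model is the free-fermion ground state of the
critical transverse-field Ising chain. [cite: SuzukiPTP1971, abstract and main theorem (2D Ising transfer matrix vs. quantum chain in a field)] -/
theorem exists_diagPerron_polarizedVacuum :
    ∃ Ω : Row N → ℝ, (∀ r, 0 < Ω r) ∧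
      diagTwoLayer N criticalBetaTwo *ᵥ Ω = topEigenvalue (diagTwoLayer_isHermitian (N := N) criticalBetaTwo) • Ω ∧
      IsPolarizedVacuum (isingMajorana N) (tfiLowSpace N) (tfiPol N) (fun r => (Ω r : ℂ)) := by
  obtain ⟨Ω, hΩ, hAΩ⟩ := exists_pos_eigenvector (diagTwoLayer_isHermitian (N := N) criticalBetaTwo)
    (diagTwoLayer_apply_pos criticalBetaTwo)
  exact ⟨Ω, hΩ, hAΩ, isPolarizedVacuum_diagPerron hΩ hAΩ⟩

end Vacuum

end Literature.Probability.LatticeModels
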